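import Summits.QuantumFields.BalabanUV.T4Continuum.Support.NE3SlicePoincareBudget
import Summits.QuantumFields.BalabanUV.T4Continuum.Support.NE3TopRadiusLettersL2
import Summits.QuantumFields.BalabanUV.T4Continuum.Support.NE3ExactLineSumsTower
import HarnessLib

/-!
# NE3SlicePoincareBudgetWitness (T⁴ programme, node NE3, row K6 of ruling ρ-g22-2, route H♮ — NON-VACUITY OF THE (P♮)_W BUDGET):
# THE TWO DISPLAYED BUDGET LINES OF K6c-2 HOLD, IN THE KERNEL, AT ONE EXPLICIT POINT

NE3 (node U1b) formalisation swarm `b2b-balaban-t4-ne3-formalise-*`, leaf seat `b2b-balaban-t4-ne3-formalise-leaf-03` (gen 10),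
item «K6c-2-NV» (INTENT `HOME/CLAIMS.log` l.21705).  CONTEXT.  The (P♮)_W END of route H♮ — leaf-02's K6c-2a
`NE3SlicePoincareBudget.budget` (p237300) and K6c-2b `NE3SlicePoincareCurved.slicePoincare_frameFreeBlockLandauW` — carries, besides the
tower class, TWO displayed real-number hypotheses `hSh` («SMALL-h»: `S_h ≤ 1∕2`) and `hSy` («SMALL-y»: `2·K_h·S_y + s₂ ≤ 1∕2`) written out
in the letters `M = L^(k+1)`, `ε`, `x`, `lr = loopRad d L ((prop1Radius d L)^[k] x)`, `DS = DSum d L (k+1) x`, `S2 = S2sum d L (k+1) x`,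
`Λ = L^d·(L^k)²`, `aU = radIter d L (k+1) x`, `c = card n` (derivation `HOME/t4/b2b-balaban-t4-ne3-formalise-leaf-02/g6/K6c-BUDGET.md`
§4–§5).  Two independent engines (NE3-R2 g10's D-ne3r2-g10-3 and this seat's NUM-ne3leaf03g10-1, CLAIMS.log l.21139 ∕ l.21291) agree that
they are jointly satisfiable, k-free, for `θ := M²x ≲ 2.6·10⁻⁵¹` at `ε ≈ 4·10⁻¹⁷` (d = 4, L = 2, card n = 2).  THIS FILE puts ONE point
of that region into the kernel (all [folklore], 0 def, 0 sorry):
§1 the k = 0 dictionary at d = 4, L = 2: `loopRad 4 2 x = 2560·x`, `DSum 4 2 1 x = 25600·x`, `Real.sqrt (C2sq 4 2) = 311 602 316 992`,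
   `S2sum 4 2 1 x = 2560·311602316992·x`, `radIter 4 2 1 x = 4x + 226·(1280x)²`;
§2 **`budget_lines_hold_level_one`**: `budget`'s `hSh` AND `hSy` — their TEXTS token for token — hold for d = 4, L = 2, c = 2, k = 0
   (`M = (L:ℝ)^(0+1) = 2`), `x = 10⁻⁵³` (θ = 4·10⁻⁵³), `ε = 10⁻¹⁷`, with `lr`, `DS`, `S2`, `Λ`, `aU` THE TREE'S TERMS at that point
   (engine 2, exact rationals at k = 0: `S_h = 0.25000000000010`, `2K_h·S_y + s₂ = 0.1136`; the kernel proof bounds `√2 ≤ 3∕2`, `√8 ≤ 3`);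
§3 the other displayed numeric binders of the END at the same point: K6-Ξ's `hsmall` (`xi_small_level_one`), K-g10-2's θ-line for `hS2`
   (`S2_line_level_one` ⇒ `S2sum 4 2 1 x ≤ rho 4 2 ∕ 2` via `S2sum_le_half_rho_of_le`), `LevelSmall 4 2 0 x` (`levelSmall_level_one`);
   6b's `hE` is `NE3TopRadiusLetters.E_le_half_of_levelSmall` — so EVERY real-number hypothesis of the (P♮)_W END is met at one point;
(the companion file `NE3SlicePoincareLevelOne` feeds these to K6c-2b `NE3SlicePoincareCurved.slicePoincare_frameFreeBlockLandauW`, p237604: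
   (P♮)_W at level one for d = 4, L = 2, card n = 2 with ALL SEVEN displayed numeric hypotheses supplied);
§4 (junction `example`): the JUNCTION — K6c-2a `NE3SlicePoincareBudget.budget` (p237300) partially applied at these letters with `hSh`∕`hSy`
   SUPPLIED by §2 (the texts unify in the kernel); what remains are the structural hypotheses and signs only.
§5 (v1.1 append): the SAME two lines and K6-Ξ's `hsmall` at `c = card n = 3` (SU(3)), all else unchanged
   (`budget_lines_hold_level_one_three`, `xi_small_level_one_three`; exact `2K_h·S_y + s₂ = 0.1732`, kernel bounds `√3 ≤ 7∕4`, `√12 ≤ 7∕2`).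
HONEST FRAMING.  A NON-VACUITY witness for OUR displayed constants at ONE level (k = 0) and one (x, ε); the k-FREE statement («for all k,
θ ≲ 2.6e-51 suffices») is the two engines' arithmetic, NOT this file's; nothing about Bałaban's minimisers; (P♮)_W itself is leaf-02's
K6c-2b, not this file; (ML_w) at `W ≠ 1`, T-E_w and NE3 are NOT proved; spine PROVED 0∕9; finite T⁴ rung (B)+1 — NOT infinite volume,
NOT mass gap, NOT BetaPertH, NOT Clay.  ABSOLUTE RULE kept (no printed sentence is a hypothesis).  PLACEMENT: `Summits/QuantumFields/BalabanUV/`;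
imports accepted modules only (`NE3SlicePoincareBudget` p237300, `NE3TopRadiusLettersL2`, `NE3ExactLineSumsTower`); moves nothing.  HONEST DEPENDENCY: continuum YM on T⁴ ⇐ BetaPertH ∧ nine spine estimates (0/9 proved);
BetaPertH ⇐ (D1) ∧ (D4) ∧ CAP+tail; G-an2-4 gates asym, D1 and NE2/3/4.
-/

set_option autoImplicit false

namespace Summit.QuantumFields.BalabanUV.T4Continuum.NE3SlicePoincareBudgetWitness

open Literature.MathematicalPhysics.QuantumFieldTheory.Balaban1983to89
open AveragingDeficitTwoLevelPrep (twoLevelSmall prop1Radius)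
open B7Prop1Explicit
open T4AveragingDeficitWall (IsUnitaryCfg SmallField)
open T4AveragingDeficitWallBoundary (IsPeriodicCfg periodBox)
open AveragingDeficitMultiLevelPrep (LevelSmall radIter tower)
open NE3CovariantLineSumsError (Csup)
open NE3CovariantLineSumsL2 (C2sq)
open NE3CovariantLineSumsL2Tower (rho delta2 S2sum S2sum_succ)
open NE3ExactLineSumsTower (DSum DSum_succ)
open BlockAverageVaryHolo (nbRad)
open SpreadLift (loopRad)
open NE3TopRadiusLettersL2 (S2sum_le_half_rho_of_le)

noncomputable section

/-! ## §1 The k = 0 dictionary at d = 4, L = 2 -/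

/-- `loopRad 4 2 x = 2560·x`. [folklore] -/
theorem loopRad_four_two (x : ℝ) : loopRad 4 2 x = 2560 * x := by
  unfold loopRad; norm_num; ring

/-- `(prop1Radius d L)^[0] x = x`. [folklore] -/
theorem iterate_zero_apply (d L : ℕ) (x : ℝ) : (prop1Radius d L)^[0] x = x := rfl

/-- `DSum 4 2 1 x = 25600·x` (one level: `L⁰·10·loopRad x`). [folklore] -/
theorem DSum_four_two_one (x : ℝ) : DSum 4 2 (0 + 1) x = 25600 * x := by
  rw [DSum_succ]; simp only [DSum, add_zero, pow_zero, one_mul]; rw [loopRad_four_two]; ring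

/-- `C2sq 4 2` is the perfect square `311602316992²` (`nbRad 4 2 = 20`, `Csup 4 2 = 27568`, `4·27568·41⁴ = 311 602 316 992`). [folklore] -/
theorem C2sq_four_two : C2sq 4 2 = (311602316992 : ℝ) ^ 2 := by
  unfold C2sq Csup nbRad; norm_num

/-- `√(C2sq 4 2) = 311 602 316 992`. [folklore] -/
theorem sqrt_C2sq_four_two : Real.sqrt (C2sq 4 2) = 311602316992 := by
  rw [C2sq_four_two]; exact Real.sqrt_sq (by norm_num)

/-- `S2sum 4 2 1 x = 2560·311602316992·x` (one level: `delta2 x`). [folklore] -/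
theorem S2sum_four_two_one (x : ℝ) : S2sum 4 2 (0 + 1) x = 2560 * 311602316992 * x := by
  rw [S2sum_succ]; simp only [S2sum, add_zero]; unfold delta2; rw [sqrt_C2sq_four_two]; norm_num; ring

/-- `radIter 4 2 1 x = prop1Radius 4 2 x = 4x + 226·(1280x)²`. [folklore] -/
theorem radIter_four_two_one (x : ℝ) : radIter 4 2 (0 + 1) x = 4 * x + 226 * (1280 * x) ^ 2 := by
  simp only [radIter]; unfold prop1Radius; norm_num

/-! ## §2 The two displayed budget lines hold at one explicit point -/

set_option maxHeartbeats 4000000 in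
/-- **NON-VACUITY OF THE (P♮)_W BUDGET AT LEVEL ONE.**  With the letters of `NE3SlicePoincareBudget.budget` instantiated as K6c-2b does at
`k = 0` — `M = (L:ℝ)^(0+1)`, `lr = loopRad d L ((prop1Radius d L)^[0] x)`, `DS = DSum d L (0+1) x`, `S2 = S2sum d L (0+1) x`,
`Λ = (L:ℝ)^d·((L:ℝ)^0)²`, `aU = radIter d L (0+1) x` — and `d = 4`, `L = 2`, `c = 2` (= card (Fin 2)), `x = 10⁻⁵³`, `ε = 10⁻¹⁷`:
BOTH `hSh` («SMALL-h») AND `hSy` («SMALL-y») — the hypothesis texts of `budget`, token for token — HOLD.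
(Proof: the §1 dictionary, `√2 ≤ 3∕2`, `√8 ≤ 3` by `Real.sqrt_le_iff`, then rational arithmetic; both lines are affine with
non-negative coefficients in the two square roots.) [folklore] -/
theorem budget_lines_hold_level_one {d L c : ℕ} (hd : d = 4) (hL : L = 2) (hc : c = 2)
    {M ε x lr DS S2 Λ aU : ℝ} (hx : x = 1 / 10 ^ 53) (hε : ε = 1 / 10 ^ 17) (hM : M = (L : ℝ) ^ (0 + 1))
    (hlr : lr = loopRad d L ((prop1Radius d L)^[0] x)) (hDS : DS = DSum d L (0 + 1) x) (hS2 : S2 = S2sum d L (0 + 1) x)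
    (hΛ : Λ = (L : ℝ) ^ d * ((L : ℝ) ^ 0) ^ 2) (haU : aU = radIter d L (0 + 1) x) :
    ((((80 * d + 448) * (d : ℝ) ^ 2 * (M ^ 2 * x) ^ 2) + 1 / 4 + 512 * (4 * (2 * ((4 * d + 5) / 10 * DS)) ^ 2 * M ^ 2) * (c : ℝ) / M ^ 2 + 16 * (((d : ℝ) - 1) * (M - 1) * x) * (Real.sqrt ((c : ℝ) * d)) * M + 16 * (2 * (8 * lr) + 2 * (2 * (((d : ℝ) - 1) * (M - 1) * M * x))) * (Real.sqrt ((c : ℝ))) / ε ^ 2 + (18 + 1 / 4 + 16 * (2 * (8 * lr) + 2 * (2 * (((d : ℝ) - 1) * (M - 1) * M * x))) * (Real.sqrt ((c : ℝ))) / ε ^ 2) * ((2 * d * x + 32 * d * x ^ 2) * (c : ℝ) * M ^ 2)) ≤ 1 / 2)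
    ∧ (2 * (1 + (1 + 8 * ε) * (2 + (16 * (d : ℝ) * (1 / M + 2 * (((d : ℝ) - 1) * (M - 1) * x)) ^ 2 * (64 : ℝ) ^ d * (4 * (d : ℝ) ^ 2 * (M - 1) ^ 2 * x + 16 * d * lr) ^ 2 * (c : ℝ)) * 8 * M ^ 2) * ((3 * ((2 : ℝ) ^ (d + 1)) * (M ^ 2)⁻¹ + 3 * ((d : ℝ) * (1 / M + 2 * (((d : ℝ) - 1) * (M - 1) * x)) ^ 2) * (2 * ((64 : ℝ) ^ d) * (((2 : ℝ) ^ (3 * d + 2)) * d))) * ((c : ℝ) * (2 * M ^ 2 + 2 * (4 * (2 * ((4 * d + 5) / 10 * DS)) ^ 2 * M ^ 2) * (c : ℝ))) + (12 * d * (48 * ((d : ℝ) * (L : ℝ))) + 3 * ((d : ℝ) * (1 / M + 2 * (((d : ℝ) - 1) * (M - 1) * x)) ^ 2) * (2 * ((64 : ℝ) ^ d) * (48 * ((d : ℝ) * (L : ℝ))))) * (c : ℝ)))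
        * (512 * (16 * S2 ^ 2 * Λ) * (c : ℝ) / M ^ 2 + 512 * (2 * ((d : ℝ) * (20 * lr) ^ 2)) * (c : ℝ) / ε ^ 2 + 24 * ε + 8 * (8 * d * (M * (((d : ℝ) - 1) * (M - 1) * x)) ^ 2 + 2 * ((c : ℝ) * (4 * (d : ℝ) ^ 2 * (M - 1) ^ 2 * x + 16 * d * lr) ^ 2)) / ε + 16 * (((d : ℝ) - 1) * (M - 1) * x) * (Real.sqrt ((c : ℝ) * d)) * M / ε ^ 2 + 8 * (2 * (8 * lr) + 2 * (2 * (((d : ℝ) - 1) * (M - 1) * M * x))) * (Real.sqrt ((c : ℝ))) * d + (18 + 1 / 4 + 16 * (2 * (8 * lr) + 2 * (2 * (((d : ℝ) - 1) * (M - 1) * M * x))) * (Real.sqrt ((c : ℝ))) / ε ^ 2) * ((16 * (d : ℝ) ^ 2 * x ^ 2) * M ^ 4 / ε ^ 2 + ε ^ 2))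
        + ((1 + 8 * ε) * ((2 + (16 * (d : ℝ) * (1 / M + 2 * (((d : ℝ) - 1) * (M - 1) * x)) ^ 2 * (64 : ℝ) ^ d * (4 * (d : ℝ) ^ 2 * (M - 1) ^ 2 * x + 16 * d * lr) ^ 2 * (c : ℝ)) * 8 * M ^ 2) * ((3 * ((2 : ℝ) ^ (d + 1)) * (M ^ 2)⁻¹ + 3 * ((d : ℝ) * (1 / M + 2 * (((d : ℝ) - 1) * (M - 1) * x)) ^ 2) * (2 * ((64 : ℝ) ^ d) * (((2 : ℝ) ^ (3 * d + 2)) * d))) * ((c : ℝ) * (2 * (16 * S2 ^ 2 * Λ) * (c : ℝ)) + (c : ℝ) * (2 * (2 * ((d : ℝ) * (20 * lr) ^ 2)) * (c : ℝ)) * (M ^ 2 / ε ^ 2)) + (3 * ((d : ℝ) * (2 : ℝ) ^ d * (8 * ((d : ℝ) * M * x) ^ 2 + (16 / M ^ 2) * (8 * lr + 9 * (d : ℝ) ^ 2 * M ^ 2 * x) ^ 2)) + 3 * ((d : ℝ) * (1 / M + 2 * (((d : ℝ) - 1) * (M - 1) * x)) ^ 2) * (2 * ((64 : ℝ) ^ d)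 * ((2 : ℝ) ^ d * ((2 : ℝ) ^ (2 * d + 4) * (d : ℝ) ^ 2 * ((d : ℝ) - 1) ^ 2 * (aU) ^ 2 + 8 * (9 * (d : ℝ) ^ 2 * M ^ 2 * x + (d : ℝ) * (8 * lr)) ^ 2)))) * (c : ℝ) * (M ^ 2 / ε ^ 2)) + ((16 * (d : ℝ) * (1 / M + 2 * (((d : ℝ) - 1) * (M - 1) * x)) ^ 2 * (64 : ℝ) ^ d * (4 * (d : ℝ) ^ 2 * (M - 1) ^ 2 * x + 16 * d * lr) ^ 2 * (c : ℝ)) * 8 * M ^ 2 + (16 * (d : ℝ) * (1 / M + 2 * (((d : ℝ) - 1) * (M - 1) * x)) ^ 2 * (64 : ℝ) ^ d * (4 * (d : ℝ) ^ 2 * (M - 1) ^ 2 * x + 16 * d * lr) ^ 2 * (c : ℝ)) * (4 * (c : ℝ) * (4 * (d : ℝ) ^ 2 * (M - 1) ^ 2 * x + 16 * d * lr) ^ 2 + 1) * (M ^ 2 / ε ^ 2))) + 9 * ε) ≤ 1 / 2) := by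
  subst hd hL hc
  rw [iterate_zero_apply, loopRad_four_two] at hlr
  rw [DSum_four_two_one] at hDS
  rw [S2sum_four_two_one] at hS2
  rw [radIter_four_two_one] at haU
  have hM2 : M = 2 := by rw [hM]; norm_num
  have hΛ16 : Λ = 16 := by rw [hΛ]; norm_num
  subst hx hε hlr hDS hS2 haU hM2 hΛ16
  have hs2 : Real.sqrt (((2 : ℕ) : ℝ)) ≤ 3 / 2 := by
    rw [Real.sqrt_le_iff]; norm_num
  have hs8 : Real.sqrt (((2 : ℕ) : ℝ) * (4 : ℕ)) ≤ 3 := by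
    rw [Real.sqrt_le_iff]; norm_num
  have hs2' : 0 ≤ Real.sqrt (((2 : ℕ) : ℝ)) := Real.sqrt_nonneg _
  have hs8' : 0 ≤ Real.sqrt (((2 : ℕ) : ℝ) * (4 : ℕ)) := Real.sqrt_nonneg _
  generalize Real.sqrt (((2 : ℕ) : ℝ)) = s2 at hs2 hs2' ⊢
  generalize Real.sqrt (((2 : ℕ) : ℝ) * (4 : ℕ)) = s8 at hs8 hs8' ⊢
  constructor
  · norm_num
    nlinarith [hs2, hs8, hs2', hs8']
  · norm_num
    nlinarith [hs2, hs8, hs2', hs8']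

/-! ## §3 The other displayed numeric binders at the same point -/

/-- K6-Ξ's `hsmall` at d = 4, L = 2, k = 0 (`M = 2`), card n = c = 2, x = 10⁻⁵³:
`8d(M((d−1)(M−1)x))² + 2·(c·(4d²(M−1)²x + 16d·loopRad 4 2 ((prop1Radius 4 2)^[0] x))²) ≤ 1∕2` (≈ 1e-95). [folklore] -/
theorem xi_small_level_one {c : ℕ} (hc : c = 2) {x : ℝ} (hx : x = 1 / 10 ^ 53) :
    8 * (4 : ℕ) * ((((2 : ℕ) : ℝ) ^ (0 + 1)) * ((((4 : ℕ) : ℝ) - 1) * ((((2 : ℕ) : ℝ) ^ (0 + 1)) - 1) * x)) ^ 2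
      + 2 * (c * (4 * ((4 : ℕ) : ℝ) ^ 2 * (((2 : ℕ) : ℝ) ^ (0 + 1) - 1) ^ 2 * x
          + 16 * (4 : ℕ) * loopRad 4 2 ((prop1Radius 4 2)^[0] x)) ^ 2) ≤ 1 / 2 := by
  rw [iterate_zero_apply, loopRad_four_two]; subst hx hc; norm_num

/-- K-g10-2's θ-line for `hS2` at d = 4, L = 2, k = 0, x = 10⁻⁵³: `(68∕3)·5·8·√(C2sq 4 2)·(2²·x) ≤ rho 4 2 ∕ 2` (≈ 1.1e-38 ≤ 1∕4). [folklore] -/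
theorem S2_line_level_one {x : ℝ} (hx : x = 1 / 10 ^ 53) :
    68 / 3 * ((((4 : ℕ) : ℝ) + 1) * (((4 : ℕ) : ℝ) + 4)) * Real.sqrt (C2sq 4 2) * ((((2 : ℕ) : ℝ) ^ (0 + 1)) ^ 2 * x) ≤ rho 4 2 / 2 := by
  have hρ : rho 4 2 = 1 / 2 := by
    unfold rho
    rw [show (((2 : ℕ) : ℝ)) ^ 2 / (((2 : ℕ) : ℝ)) ^ 4 = ((1 : ℝ) / 2) ^ 2 by norm_num]
    exact Real.sqrt_sq (by norm_num)
  rw [sqrt_C2sq_four_two, hρ]; subst hx; norm_num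

/-- Hence `hS2` itself at that point: `S2sum 4 2 (0+1) x ≤ rho 4 2 ∕ 2`, by `NE3TopRadiusLettersL2.S2sum_le_half_rho_of_le` under the class
(`LevelSmall 4 2 0 x`, below). [folklore] -/
theorem S2sum_le_half_rho_level_one {x : ℝ} (hx : x = 1 / 10 ^ 53) : S2sum 4 2 (0 + 1) x ≤ rho 4 2 / 2 := by
  have hx0 : 0 ≤ x := by rw [hx]; norm_num
  have hs : LevelSmall 4 2 0 x := by
    show twoLevelSmall 4 2 * x ≤ 1
    unfold twoLevelSmall; rw [hx]; norm_num
  exact S2sum_le_half_rho_of_le (d := 4) (by norm_num) 0 hx0 hs (S2_line_level_one hx)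

/-- The tower class is inhabited at that radius: `LevelSmall 4 2 0 x` for `x = 10⁻⁵³` (`twoLevelSmall 4 2 = 26 843 545 600`). [folklore] -/
theorem levelSmall_level_one {x : ℝ} (hx : x = 1 / 10 ^ 53) : LevelSmall 4 2 0 x := by
  show twoLevelSmall 4 2 * x ≤ 1
  unfold twoLevelSmall; rw [hx]; norm_num

/-- … and 6b's `hE` there is the class theorem `NE3TopRadiusLetters.E_le_half_of_levelSmall` (no new line). [folklore] -/
theorem E_le_half_level_one {x : ℝ} (hx : x = 1 / 10 ^ 53) :
    4 * ((4 : ℕ) : ℝ) ^ 2 * ((((2 : ℕ) : ℝ)) ^ (0 + 1) - 1) ^ 2 * x + 16 * (4 : ℕ) * loopRad 4 2 ((prop1Radius 4 2)^[0] x) ≤ 1 / 2 :=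
  NE3TopRadiusLetters.E_le_half_of_levelSmall (d := 4) (L := 2) (by norm_num) 0 (by rw [hx]; norm_num) (levelSmall_level_one hx)

/-! ## §4 The junction with K6c-2a: `budget` ACCEPTS the witness as its `hSh` ∕ `hSy` at the level-one letters -/

/-- **JUNCTION (kernel)**: `NE3SlicePoincareBudget.budget` at `d = 4`, `L = 2`, `c = 2` and the level-one letters
`M := (2:ℝ)^(0+1)`, `ε := 10⁻¹⁷`, `x := 10⁻⁵³`, `lr := loopRad 4 2 ((prop1Radius 4 2)^[0] x)`, `DS := DSum 4 2 (0+1) x`, `S2 := S2sum 4 2 (0+1) x`,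
`Λ := 2^4·(2^0)²`, `aU := radIter 4 2 (0+1) x`, with `hSh` ∕ `hSy` SUPPLIED by `budget_lines_hold_level_one` — the remaining hypotheses are
the structural ones ((K1), (S5), Jensen, (η), (y), (Ξ), (Gt) and signs); i.e. at this point the budget's conclusion
`y ≤ 16·A·K_h·(M²·P)` needs NO displayed smallness beyond the class. (The texts unify: this is the token-level check of §2; an
`example`, since its type is `budget`'s own.) [folklore] -/
example (y h G Z r CG DG P A1 A2 Gt Xi : ℝ) :=
  @NE3SlicePoincareBudget.budget 4 2 2 (by norm_num)
    (((2 : ℕ) : ℝ) ^ (0 + 1)) (1 / 10 ^ 17) (1 / 10 ^ 53) (loopRad 4 2 ((prop1Radius 4 2)^[0] (1 / 10 ^ 53)))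
    (DSum 4 2 (0 + 1) (1 / 10 ^ 53)) (S2sum 4 2 (0 + 1) (1 / 10 ^ 53)) (((2 : ℕ) : ℝ) ^ 4 * (((2 : ℕ) : ℝ) ^ 0) ^ 2)
    (radIter 4 2 (0 + 1) (1 / 10 ^ 53)) y h G Z r CG DG P A1 A2 Gt Xi
    (hSh := (budget_lines_hold_level_one rfl rfl rfl rfl rfl rfl rfl rfl rfl rfl rfl).1)
    (hSy := (budget_lines_hold_level_one rfl rfl rfl rfl rfl rfl rfl rfl rfl rfl rfl).2)


/-! ## §5 The same point for SU(3): `card n = c = 3` (v1.1 append) -/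

/-- **SU(3)**: the two displayed budget lines of `NE3SlicePoincareBudget.budget` ALSO hold at `c = card n = 3` and otherwise the SAME
point (d = 4, L = 2, k = 0, x = 10⁻⁵³, ε = 10⁻¹⁷): exact values `S_h = 0.25000000000011…`, `2K_h·S_y + s₂ = 0.17318…` (engine 2,
exact rationals + 60-digit √); the kernel uses `√3 ≤ 7∕4`, `√12 ≤ 7∕2`. Same texts, same dictionary, `hc : c = 3`. [folklore] -/
theorem budget_lines_hold_level_one_three {d L c : ℕ} (hd : d = 4) (hL : L = 2) (hc : c = 3)
    {M ε x lr DS S2 Λ aU : ℝ} (hx : x = 1 / 10 ^ 53) (hε : ε = 1 / 10 ^ 17) (hM : M = (L : ℝ) ^ (0 + 1))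
    (hlr : lr = loopRad d L ((prop1Radius d L)^[0] x)) (hDS : DS = DSum d L (0 + 1) x) (hS2 : S2 = S2sum d L (0 + 1) x)
    (hΛ : Λ = (L : ℝ) ^ d * ((L : ℝ) ^ 0) ^ 2) (haU : aU = radIter d L (0 + 1) x) :
    ((((80 * d + 448) * (d : ℝ) ^ 2 * (M ^ 2 * x) ^ 2) + 1 / 4 + 512 * (4 * (2 * ((4 * d + 5) / 10 * DS)) ^ 2 * M ^ 2) * (c : ℝ) / M ^ 2 + 16 * (((d : ℝ) - 1) * (M - 1) * x) * (Real.sqrt ((c : ℝ) * d)) * M + 16 * (2 * (8 * lr) + 2 * (2 * (((d : ℝ) - 1) * (M - 1) * M * x))) * (Real.sqrt ((c : ℝ))) / ε ^ 2 + (18 + 1 / 4 + 16 * (2 * (8 * lr) + 2 * (2 * (((d : ℝ) - 1) * (M - 1) * M * x))) * (Real.sqrt ((c : ℝ))) / ε ^ 2) * ((2 * d * x + 32 * d * x ^ 2) * (c : ℝ) * M ^ 2)) ≤ 1 / 2)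
    ∧ (2 * (1 + (1 + 8 * ε) * (2 + (16 * (d : ℝ) * (1 / M + 2 * (((d : ℝ) - 1) * (M - 1) * x)) ^ 2 * (64 : ℝ) ^ d * (4 * (d : ℝ) ^ 2 * (M - 1) ^ 2 * x + 16 * d * lr) ^ 2 * (c : ℝ)) * 8 * M ^ 2) * ((3 * ((2 : ℝ) ^ (d + 1)) * (M ^ 2)⁻¹ + 3 * ((d : ℝ) * (1 / M + 2 * (((d : ℝ) - 1) * (M - 1) * x)) ^ 2) * (2 * ((64 : ℝ) ^ d) * (((2 : ℝ) ^ (3 * d + 2)) * d))) * ((c : ℝ) * (2 * M ^ 2 + 2 * (4 * (2 * ((4 * d + 5) / 10 * DS)) ^ 2 * M ^ 2) * (c : ℝ))) + (12 * d * (48 * ((d : ℝ) * (L : ℝ))) + 3 * ((d : ℝ) * (1 / M + 2 * (((d : ℝ) - 1) * (M - 1) * x)) ^ 2) * (2 * ((64 : ℝ) ^ d) * (48 * ((d : ℝ) * (L : ℝ))))) * (c : ℝ)))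
        * (512 * (16 * S2 ^ 2 * Λ) * (c : ℝ) / M ^ 2 + 512 * (2 * ((d : ℝ) * (20 * lr) ^ 2)) * (c : ℝ) / ε ^ 2 + 24 * ε + 8 * (8 * d * (M * (((d : ℝ) - 1) * (M - 1) * x)) ^ 2 + 2 * ((c : ℝ) * (4 * (d : ℝ) ^ 2 * (M - 1) ^ 2 * x + 16 * d * lr) ^ 2)) / ε + 16 * (((d : ℝ) - 1) * (M - 1) * x) * (Real.sqrt ((c : ℝ) * d)) * M / ε ^ 2 + 8 * (2 * (8 * lr) + 2 * (2 * (((d : ℝ) - 1) * (M - 1) * M * x))) * (Real.sqrt ((c : ℝ))) * d + (18 + 1 / 4 + 16 * (2 * (8 * lr) + 2 * (2 * (((d : ℝ) - 1) * (M - 1) * M * x))) * (Real.sqrt ((c : ℝ))) / ε ^ 2) * ((16 * (d : ℝ) ^ 2 * x ^ 2) * M ^ 4 / ε ^ 2 + ε ^ 2))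
        + ((1 + 8 * ε) * ((2 + (16 * (d : ℝ) * (1 / M + 2 * (((d : ℝ) - 1) * (M - 1) * x)) ^ 2 * (64 : ℝ) ^ d * (4 * (d : ℝ) ^ 2 * (M - 1) ^ 2 * x + 16 * d * lr) ^ 2 * (c : ℝ)) * 8 * M ^ 2) * ((3 * ((2 : ℝ) ^ (d + 1)) * (M ^ 2)⁻¹ + 3 * ((d : ℝ) * (1 / M + 2 * (((d : ℝ) - 1) * (M - 1) * x)) ^ 2) * (2 * ((64 : ℝ) ^ d) * (((2 : ℝ) ^ (3 * d + 2)) * d))) * ((c : ℝ) * (2 * (16 * S2 ^ 2 * Λ) * (c : ℝ)) + (c : ℝ) * (2 * (2 * ((d : ℝ) * (20 * lr) ^ 2)) * (c : ℝ)) * (M ^ 2 / ε ^ 2)) + (3 * ((d : ℝ) * (2 : ℝ) ^ d * (8 * ((d : ℝ) * M * x) ^ 2 + (16 / M ^ 2) * (8 * lr + 9 * (d : ℝ) ^ 2 * M ^ 2 * x) ^ 2)) + 3 * ((d : ℝ) * (1 / M + 2 * (((d : ℝ) - 1) * (M - 1) * x)) ^ 2) * (2 * ((64 : ℝ) ^ d)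 * ((2 : ℝ) ^ d * ((2 : ℝ) ^ (2 * d + 4) * (d : ℝ) ^ 2 * ((d : ℝ) - 1) ^ 2 * (aU) ^ 2 + 8 * (9 * (d : ℝ) ^ 2 * M ^ 2 * x + (d : ℝ) * (8 * lr)) ^ 2)))) * (c : ℝ) * (M ^ 2 / ε ^ 2)) + ((16 * (d : ℝ) * (1 / M + 2 * (((d : ℝ) - 1) * (M - 1) * x)) ^ 2 * (64 : ℝ) ^ d * (4 * (d : ℝ) ^ 2 * (M - 1) ^ 2 * x + 16 * d * lr) ^ 2 * (c : ℝ)) * 8 * M ^ 2 + (16 * (d : ℝ) * (1 / M + 2 * (((d : ℝ) - 1) * (M - 1) * x)) ^ 2 * (64 : ℝ) ^ d * (4 * (d : ℝ) ^ 2 * (M - 1) ^ 2 * x + 16 * d * lr) ^ 2 * (c : ℝ)) * (4 * (c : ℝ) * (4 * (d : ℝ) ^ 2 * (M - 1) ^ 2 * x + 16 * d * lr) ^ 2 + 1) * (M ^ 2 / ε ^ 2))) + 9 * ε) ≤ 1 / 2) := by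
  subst hd hL hc
  rw [iterate_zero_apply, loopRad_four_two] at hlr
  rw [DSum_four_two_one] at hDS
  rw [S2sum_four_two_one] at hS2
  rw [radIter_four_two_one] at haU
  have hM2 : M = 2 := by rw [hM]; norm_num
  have hΛ16 : Λ = 16 := by rw [hΛ]; norm_num
  subst hx hε hlr hDS hS2 haU hM2 hΛ16
  have hs3 : Real.sqrt (((3 : ℕ) : ℝ)) ≤ 7 / 4 := by
    rw [Real.sqrt_le_iff]; norm_num
  have hs12 : Real.sqrt (((3 : ℕ) : ℝ) * (4 : ℕ)) ≤ 7 / 2 := by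
    rw [Real.sqrt_le_iff]; norm_num
  have hs3' : 0 ≤ Real.sqrt (((3 : ℕ) : ℝ)) := Real.sqrt_nonneg _
  have hs12' : 0 ≤ Real.sqrt (((3 : ℕ) : ℝ) * (4 : ℕ)) := Real.sqrt_nonneg _
  generalize Real.sqrt (((3 : ℕ) : ℝ)) = s3 at hs3 hs3' ⊢
  generalize Real.sqrt (((3 : ℕ) : ℝ) * (4 : ℕ)) = s12 at hs12 hs12' ⊢
  constructor
  · norm_num
    nlinarith [hs3, hs12, hs3', hs12']
  · norm_num
    nlinarith [hs3, hs12, hs3', hs12']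

/-- K6-Ξ's `hsmall` at the same point with `c = 3` (≈ 1.6e-95 ≤ 1∕2). [folklore] -/
theorem xi_small_level_one_three {c : ℕ} (hc : c = 3) {x : ℝ} (hx : x = 1 / 10 ^ 53) :
    8 * (4 : ℕ) * ((((2 : ℕ) : ℝ) ^ (0 + 1)) * ((((4 : ℕ) : ℝ) - 1) * ((((2 : ℕ) : ℝ) ^ (0 + 1)) - 1) * x)) ^ 2
      + 2 * (c * (4 * ((4 : ℕ) : ℝ) ^ 2 * (((2 : ℕ) : ℝ) ^ (0 + 1) - 1) ^ 2 * x
          + 16 * (4 : ℕ) * loopRad 4 2 ((prop1Radius 4 2)^[0] x)) ^ 2) ≤ 1 / 2 := by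
  rw [iterate_zero_apply, loopRad_four_two]; subst hx hc; norm_num

end

end Summit.QuantumFields.BalabanUV.T4Continuum.NE3SlicePoincareBudgetWitness
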